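import Mathlib.Geometry.Manifold.ChartedSpace
import Literature.AlgebraicTopology.SingularHomology.LocalHomology
import Literature.AlgebraicTopology.SingularHomology.NoncompactManifold
import HarnessLib

/-!
# Hatcher's Lemma 3.27 and Prop. 3.29 (top homology of non-compact manifolds vanishes) — proofs

A. Hatcher, *Algebraic Topology*, CUP 2002, §3.3: Lemma 3.27 (p. 236) computes the local homology
`Hᵢ(X | K) = Hᵢ(X, X ∖ K)` at compact subsets `K` of `ℝⁿ` and of `n`-manifolds, and Prop. 3.29
(p. 239) deduces: *if `X` is a connected non-compact `n`-manifold then `Hᵢ(X; R) = 0` for `i ≥ n`*.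
This file proves both (in the form needed: the property `P(A)` — our label for what the printed
proof of Lemma 3.27 establishes inductively, `Literature.AlgebraicTopology.SingularHomology.clocalHomology.PtDetermined` of `…LocalHomology`,
i.e. Lemma 3.27 (b) and the uniqueness half of (a)) in the concrete singular chain model, for all `n` and all coefficient modules, and thereby
discharges the named fact `Literature.isZero_singularHomology_of_noncompactSpace R X n` of
`…NoncompactManifold` for `X : Type`. No definitions; everything is proved.

**Part A — `P(K)` for compact `K ⊆ ℝⁿ` (Lemma 3.27, steps (1)–(3)).**

* quotients by quasi-isomorphic subcomplexes and relative Mayer–Vietoris (injectivity part):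
  `Subcomplex.isIso_homologyMap_quotientMap` (five lemma), `Subcomplex.eq_zero_of_mvQuot`,
  `clocalHomology.eq_zero_of_res_union`;
* `ℝⁿ` at bounded star-shaped `K ∋ x`: `clocalHomology.isIso_res_singleton_of_starConvex`
  (`Hᵢ(ℝⁿ | K) ≅ Hᵢ(ℝⁿ | x)`, all `i`, since `ℝⁿ ∖ K ↪ ℝⁿ ∖ x` is a homotopy equivalence,
  `…PuncturedEuclidean`) and `isZero_of_starConvex` (`Hᵢ(ℝⁿ | K) = 0` for `i > n ≥ 1`, from the
  homology of `ℝⁿ ∖ 0`, `…LocalHomology`);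
* closure properties of `P`: `ptDetermined_empty`, `ptDetermined_union`, `ptDetermined_biUnion`
  (step (1)), transport `PtDetermined.of_map`, `PtDetermined.map_of` along maps inducing
  isomorphisms (resp. epi/monomorphisms), and the Euclidean cases `ptDetermined_of_starConvex`,
  `ptDetermined_of_convex`, `ptDetermined_biUnion_convex` (steps (2), (3)) culminating in
  **`ptDetermined_of_isCompact_rvec`**: `P(K)` for every compact `K ⊆ ℝⁿ`, `n ≥ 1` (step (3), by
  approximating a relative cycle's class from a finite union of closed balls,
  `exists_res_ballUnion_eq`).

**Part B — Lemma 3.27 (4) on manifolds and Prop. 3.29** (spaces `X : Type`, see Part B's header):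

* `clocalHomology.ptDetermined_of_subset_source`, `ptDetermined_of_isCompact` — Lemma 3.27 (4):
  `P(K)` for compact `K` in a Hausdorff manifold modelled on `EuclideanSpace ℝ (Fin n)`, by
  excision into a chart and finite unions;
* `clocalHomology.exists_nhds_res_mono` — local constancy: near each point `x` the restrictions
  `Hₙ(X | B) → Hₙ(X | y)` from a closed chart ball `B` are injective;
* `clocalHomology.relCls_singleton_eq_zero` — on a connected non-compact manifold the "section"
  `x ↦ [z]ₓ ∈ Hₙ(X | x)` of an `n`-cycle `z` vanishes identically (it vanishes off the compact
  carrier of `z`, and its zero set is open and closed);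
* **`clocalHomology.isZero_csingularHomology_of_noncompact`** (Prop. 3.29 in the concrete model;
  `_of_pos` for `n ≥ 1`, and `not_noncompactSpace_of_chartedSpace_fin_zero` disposing of `n = 0`),
  **`clocalHomology.isZero_singularHomology_of_noncompact`** (for `Literature.AlgebraicTopology.SingularHomology.singularHomology`, via the
  comparison isomorphism `csingularHomology.compIso`), and the discharge
  **`isZero_singularHomology_of_noncompactSpace_holds R (X : Type) n :
  isZero_singularHomology_of_noncompactSpace R X n`**.

The existence half of Lemma 3.27 (a) (sections) is not needed for Prop. 3.29 and not formalised.
The dimension is restricted to `n ≥ 1` where stated in Part A (`P` is about degrees `≥ n`, and the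
vanishing goes through `H(ℝⁿ ∖ 0)` in positive degrees); Part B disposes of `n = 0` separately.
Deviations from the printed proof of Prop. 3.29: the long exact sequence of the triple
`(X, U ∪ V, V)` is replaced by the equivalent bookkeeping with relative cycles
(`Subcomplex.relCls_eq_zero_iff`); manifolds are `[T2Space X] [ChartedSpace (EuclideanSpace ℝ
(Fin n)) X]` as in the named fact (no second countability, as in Hatcher p. 231). Published
statements carry `[cite: HatcherAT2002, …]`, glue lemmas are [folklore]. Each part is a
self-contained `noncomputable section` (its `universe`/`open`/`set_option` lines are scoped to it).

## References

* A. Hatcher, *Algebraic Topology*, CUP 2002, §3.3: p. 231 (manifolds, local homology),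
  Lemma 3.27 (p. 236), Prop. 3.29 (p. 239); §2.1 Thm. 2.20; §2.2 p. 152 (relative Mayer–Vietoris).
-/

noncomputable section

-- as in `SingularChainsConcrete`: chains of the concrete complex are `Finsupp`s up to unfolding
set_option backward.isDefEq.respectTransparency false

open CategoryTheory Limits

universe u v w

namespace Literature.AlgebraicTopology.SingularHomology

variable (R : Type v) [CommRing R] (M : Type v) [AddCommGroup M] [Module R M]
variable {X Y Z : Type u} [TopologicalSpace X] [TopologicalSpace Y] [TopologicalSpace Z]

/-! ### Algebra: quotients by quasi-isomorphic subcomplexes; relative Mayer–Vietoris -/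

namespace Subcomplex

variable {R' : Type v} [CommRing R'] {β : Type*} {c : ComplexShape β}
  {K : HomologicalComplex (ModuleCat.{w} R') c}

/-- If `S ≤ T` and the inclusion `S ↪ T` is a quasi-isomorphism, then `K/S ⟶ K/T` is a
quasi-isomorphism (five lemma on the two long exact sequences; Hatcher 2002, §2.2, the passage
from `C(A) + C(B)` to `C(A ∪ B)` in relative Mayer–Vietoris). [folklore] -/
theorem isIso_homologyMap_quotientMap {S T : Subcomplex K} (h : S ≤ T)
    (hiso : ∀ i, IsIso (HomologicalComplex.homologyMap (incl h) i)) (i : β) :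
    IsIso (HomologicalComplex.homologyMap (quotientMap h) i) := by
  have h₁ : Epi (HomologicalComplex.homologyMap (shortComplexMap (𝟙 K) S T h).τ₁ i) := by
    haveI := hiso i
    change Epi (HomologicalComplex.homologyMap (incl h) i)
    infer_instance
  have h₂ : IsIso (HomologicalComplex.homologyMap (shortComplexMap (𝟙 K) S T h).τ₂ i) := by
    change IsIso (HomologicalComplex.homologyMap (𝟙 K) i)
    infer_instance
  have h₃ : ∀ j, c.Rel i j →
      IsIso (HomologicalComplex.homologyMap (shortComplexMap (𝟙 K) S T h).τ₁ j) := fun j _ => by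
    haveI := hiso j
    change IsIso (HomologicalComplex.homologyMap (incl h) j)
    infer_instance
  have h₄ : ∀ j, c.Rel i j →
      Mono (HomologicalComplex.homologyMap (shortComplexMap (𝟙 K) S T h).τ₂ j) := fun j _ => by
    change Mono (HomologicalComplex.homologyMap (𝟙 K) j)
    infer_instance
  exact HomologicalComplex.HomologySequence.isIso_homologyMap_τ₃
    (shortComplexMap (𝟙 K) S T h) (shortExact S) (shortExact T) i h₁ h₂ h₃ h₄

/-- **Relative Mayer–Vietoris, injectivity part** (Hatcher 2002, §2.2, p. 152 and proof of
Lemma 3.27, step (1)): if `S ⊔ T ↪ U` is a quasi-isomorphism and `Hᵢ(K/U) = 0`, then a class in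
`Hⱼ(K/(S ⊓ T))` (`c.Rel i j`) with vanishing images in `Hⱼ(K/S)` and `Hⱼ(K/T)` is zero
(exactness of `Hᵢ(K/(S ⊔ T)) → Hⱼ(K/(S ⊓ T)) → Hⱼ(K/S) ⊕ Hⱼ(K/T)`). [folklore] -/
theorem eq_zero_of_mvQuot {S T U : Subcomplex K} (hU : S ⊔ T ≤ U)
    (hincl : ∀ k, IsIso (HomologicalComplex.homologyMap (incl hU) k)) {i j : β} (hij : c.Rel i j)
    (hzero : IsZero (U.quotient.homology i)) (x : (S ⊓ T).quotient.homology j)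
    (h₁ : HomologicalComplex.homologyMap (quotientMap (inf_le_left : S ⊓ T ≤ S)) j x = 0)
    (h₂ : HomologicalComplex.homologyMap (quotientMap (inf_le_right : S ⊓ T ≤ T)) j x = 0) :
    x = 0 := by
  have hz' : IsZero ((S ⊔ T).quotient.homology i) := by
    haveI := isIso_homologyMap_quotientMap hU hincl i
    exact hzero.of_iso (asIso (HomologicalComplex.homologyMap (quotientMap hU) i))
  have hex := (mvQuot_shortExact S T).homology_exact₁ i j hij
  have hδ : (mvQuot_shortExact S T).δ i j hij = 0 := hz'.eq_of_src _ _
  have hmono : Mono (HomologicalComplex.homologyMap (mvQuot S T).f j) := hex.mono_g hδ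
  have hFx : HomologicalComplex.homologyMap (mvQuot S T).f j x = 0 := by
    rw [mvQuot_f]
    exact (homologyMap_lift_eq_zero_iff _ _ x).mpr ⟨h₁, h₂⟩
  exact (ModuleCat.mono_iff_injective _).mp hmono (hFx.trans (map_zero _).symm)

end Subcomplex

/-! ### Local homology of `ℝⁿ` at bounded star-shaped sets -/

namespace clocalHomology

variable {n : ℕ}

/-- The forward map of `complStarConvexHomotopyEquiv` is the inclusion `ℝⁿ ∖ K ↪ ℝⁿ ∖ {x}`. [folklore] -/
lemma complStarConvexHomotopyEquiv_toFun {K : Set (RVec n)} {x : RVec n} (hK : StarConvex ℝ x K)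
    (hx : x ∈ K) (ρ : ℝ) (hρ : ∀ v ∈ K, ‖v - x‖ < ρ) :
    ((complStarConvexHomotopyEquiv hK hx ρ hρ).toFun : C(↥Kᶜ, ↥({x}ᶜ : Set (RVec n)))) =
      ⟨Set.inclusion (Set.compl_subset_compl.mpr (Set.singleton_subset_iff.mpr hx)),
        continuous_inclusion _⟩ :=
  rfl

/-- **Local homology of `ℝⁿ` at a bounded star-shaped set restricts isomorphically to its centre**:
`Hᵢ(ℝⁿ | K) ⟶ Hᵢ(ℝⁿ | x)` is an isomorphism for all `i`, for `K` bounded and star-shaped about `x ∈ K`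
(Hatcher 2002, proof of Lemma 3.27, step (2)): the inclusion `ℝⁿ ∖ K ↪ ℝⁿ ∖ x` is a homotopy
equivalence, so `C(ℝⁿ ∖ K) ↪ C(ℝⁿ ∖ x)` and hence `C(ℝⁿ)/C(ℝⁿ ∖ K) ⟶ C(ℝⁿ)/C(ℝⁿ ∖ x)` are
quasi-isomorphisms (five lemma). [folklore] -/
theorem isIso_res_singleton_of_starConvex {K : Set (RVec n)} {x : RVec n} (hK : StarConvex ℝ x K)
    (hx : x ∈ K) (hKb : ∃ ρ : ℝ, ∀ v ∈ K, ‖v - x‖ < ρ) (i : ℕ) :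
    IsIso (res R M (RVec n) (Set.singleton_subset_iff.mpr hx) i) := by
  obtain ⟨ρ, hρ⟩ := hKb
  have hincl : ∀ k, IsIso (HomologicalComplex.homologyMap
      (Subcomplex.incl (awaySub_mono R M (Set.singleton_subset_iff.mpr hx))) k) := fun k => by
    refine isIso_homologyMap_incl_of_isIso R M
      (Set.compl_subset_compl.mpr (Set.singleton_subset_iff.mpr hx)) k ?_
    have e := complStarConvexHomotopyEquiv_toFun hK hx ρ hρ
    have hi : IsIso (csingularHomology.isoOfHomotopyEquiv R M (complStarConvexHomotopyEquiv hK hx ρ hρ)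
      k).hom := inferInstance
    rwa [csingularHomology.isoOfHomotopyEquiv_hom, e] at hi
  rw [res_eq]
  exact Subcomplex.isIso_homologyMap_quotientMap _ hincl i

/-- **Local homology of `ℝⁿ` at a bounded star-shaped set vanishes above degree `n`** (`n ≥ 1`):
`Hᵢ(ℝⁿ | K) = 0` for `i > n` (Hatcher 2002, proof of Lemma 3.27 (2): `≅ H̃ᵢ₋₁(Sⁿ⁻¹) = 0`). [folklore] -/
theorem isZero_of_starConvex {K : Set (RVec n)} {x : RVec n} (hK : StarConvex ℝ x K)
    (hx : x ∈ K) (hKb : ∃ ρ : ℝ, ∀ v ∈ K, ‖v - x‖ < ρ) (hn : 1 ≤ n) {i : ℕ} (hi : n < i) :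
    IsZero (clocalHomology R M (RVec n) K i) := by
  obtain ⟨ρ, hρ⟩ := hKb
  obtain ⟨j, rfl⟩ : ∃ j, i = j + 1 := ⟨i - 1, by omega⟩
  have h1 : IsZero (csingularHomology R M (RVec n) (j + 1)) :=
    isZero_csingularHomology_of_contractibleSpace R M (by omega)
  have h0 : IsZero (csingularHomology R M (RVec n) j) :=
    isZero_csingularHomology_of_contractibleSpace R M (by omega)
  haveI := isIso_δ R M K j h1 h0
  refine IsZero.of_iso ?_ (asIso (δ R M (RVec n) K j) ≪≫ homologySubIso R M (RVec n) Kᶜ j ≪≫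
    csingularHomology.isoOfHomotopyEquiv R M (complStarConvexHomotopyEquiv hK hx ρ hρ) j ≪≫
    csingularHomology.mapIso R M (complSingletonHomeomorph x) j)
  exact isZero_homology_punctured R M n j (by omega) (by omega)

end clocalHomology

namespace clocalHomology

/-- `C(X ∖ (A ∪ B)) = C(X ∖ A) ⊓ C(X ∖ B)`. [folklore] -/
lemma awaySub_union (A B : Set X) :
    awaySub R M X (A ∪ B) = awaySub R M X A ⊓ awaySub R M X B := by
  change chainsInSub R M X (A ∪ B)ᶜ = _
  rw [Set.compl_union]
  exact chainsInSub_inter R M Aᶜ Bᶜ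

/-- `C(X ∖ A) + C(X ∖ B) ≤ C(X ∖ (A ∩ B))`. [folklore] -/
lemma sup_awaySub_le (A B : Set X) :
    awaySub R M X A ⊔ awaySub R M X B ≤ awaySub R M X (A ∩ B) := by
  change _ ≤ chainsInSub R M X (A ∩ B)ᶜ
  rw [Set.compl_inter]
  exact chainsInSub_sup_le R M Aᶜ Bᶜ

/-- For closed `A`, `B` the inclusion `C(X ∖ A) + C(X ∖ B) ↪ C(X ∖ (A ∩ B))` is a
quasi-isomorphism (Prop. 2.21 for the open cover `{X ∖ A, X ∖ B}` of `X ∖ (A ∩ B)`).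
[cite: HatcherAT2002, Prop. 2.21] -/
lemma isIso_homologyMap_incl_sup_awaySub {A B : Set X} (hA : IsClosed A) (hB : IsClosed B)
    (k : ℕ) :
    IsIso (HomologicalComplex.homologyMap (Subcomplex.incl (sup_awaySub_le R M A B)) k) := by
  have e : chainsInSub R M X (Aᶜ ∪ Bᶜ) = awaySub R M X (A ∩ B) := by
    change _ = chainsInSub R M X (A ∩ B)ᶜ
    rw [Set.compl_inter]
  have h1 := isIso_homologyMap_incl_sup R M hA.isOpen_compl hB.isOpen_compl k
  haveI := Subcomplex.isIso_incl_of_eq e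
  have hfac : Subcomplex.incl (sup_awaySub_le R M A B) =
      Subcomplex.incl (chainsInSub_sup_le R M Aᶜ Bᶜ) ≫ Subcomplex.incl e.le :=
    (Subcomplex.incl_comp_incl _ _).symm
  rw [hfac, HomologicalComplex.homologyMap_comp]
  haveI := h1
  infer_instance

/-- **Relative Mayer–Vietoris for local homology, injectivity part** (Hatcher 2002, §2.2 p. 152
and proof of Lemma 3.27 (1)): for closed `A`, `B` with `Hᵢ₊₁(X | A ∩ B) = 0`, a class in
`Hᵢ(X | A ∪ B)` restricting to zero in `Hᵢ(X | A)` and in `Hᵢ(X | B)` is zero. [folklore] -/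
theorem eq_zero_of_res_union {A B : Set X} (hA : IsClosed A) (hB : IsClosed B) {i : ℕ}
    (hz : IsZero (clocalHomology R M X (A ∩ B) (i + 1))) (α : clocalHomology R M X (A ∪ B) i)
    (h₁ : res R M X (Set.subset_union_left : A ⊆ A ∪ B) i α = 0)
    (h₂ : res R M X (Set.subset_union_right : B ⊆ A ∪ B) i α = 0) : α = 0 := by
  have hle : awaySub R M X (A ∪ B) ≤ awaySub R M X A ⊓ awaySub R M X B :=
    (awaySub_union R M A B).le
  have hge : awaySub R M X A ⊓ awaySub R M X B ≤ awaySub R M X (A ∪ B) :=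
    (awaySub_union R M A B).ge
  have hx0 : HomologicalComplex.homologyMap (Subcomplex.quotientMap hle) i α = 0 := by
    refine Subcomplex.eq_zero_of_mvQuot (sup_awaySub_le R M A B)
      (isIso_homologyMap_incl_sup_awaySub R M hA hB) (i := i + 1) (j := i) rfl hz _ ?_ ?_
    · have e : Subcomplex.quotientMap hle ≫ Subcomplex.quotientMap
          (inf_le_left : awaySub R M X A ⊓ awaySub R M X B ≤ awaySub R M X A) =
          Subcomplex.quotientMap (awaySub_mono R M (Set.subset_union_left : A ⊆ A ∪ B)) :=
        Subcomplex.quotientMap_comp_quotientMap _ _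
      rw [← ModuleCat.comp_apply, ← HomologicalComplex.homologyMap_comp, e, ← res_eq]
      exact h₁
    · have e : Subcomplex.quotientMap hle ≫ Subcomplex.quotientMap
          (inf_le_right : awaySub R M X A ⊓ awaySub R M X B ≤ awaySub R M X B) =
          Subcomplex.quotientMap (awaySub_mono R M (Set.subset_union_right : B ⊆ A ∪ B)) :=
        Subcomplex.quotientMap_comp_quotientMap _ _
      rw [← ModuleCat.comp_apply, ← HomologicalComplex.homologyMap_comp, e, ← res_eq]
      exact h₂
  have hid : Subcomplex.quotientMap hle ≫ Subcomplex.quotientMap hge = 𝟙 _ := by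
    rw [Subcomplex.quotientMap_comp_quotientMap]
    exact Subcomplex.quotMap_id _ _
  have e : α = HomologicalComplex.homologyMap (Subcomplex.quotientMap hge) i
      (HomologicalComplex.homologyMap (Subcomplex.quotientMap hle) i α) := by
    rw [← ModuleCat.comp_apply, ← HomologicalComplex.homologyMap_comp, hid,
      HomologicalComplex.homologyMap_id]
    rfl
  rw [e, hx0, map_zero]

/-! ### The property `P(A)` (our label) of the proof of Lemma 3.27: vanishing above `n`, detection by points in degree `n` -/

/-- An object of `ModuleCat` all of whose elements vanish is a zero object. [folklore] -/
lemma isZero_of_forall_eq_zero {N : ModuleCat.{w} R} (h : ∀ x : N, x = 0) : IsZero N :=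
  @ModuleCat.isZero_of_subsingleton _ _ N ⟨fun a b => (h a).trans (h b).symm⟩

/-- `P(∅)` holds: `H(X | ∅) = 0`. [folklore] -/
theorem ptDetermined_empty (n : ℕ) : PtDetermined R M X n (∅ : Set X) :=
  ⟨fun i _ => isZero_empty R M i, fun α _ => by
    haveI := ModuleCat.subsingleton_of_isZero (isZero_empty R M (X := X) n)
    exact Subsingleton.elim _ _⟩

/-- **Lemma 3.27, step (1)**: if `A`, `B` are closed and `P(A)`, `P(B)`, `P(A ∩ B)` hold, then
`P(A ∪ B)` holds (relative Mayer–Vietoris). [cite: HatcherAT2002, Lemma 3.27] -/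
theorem ptDetermined_union {n : ℕ} {A B : Set X} (hA : IsClosed A) (hB : IsClosed B)
    (hPA : PtDetermined R M X n A) (hPB : PtDetermined R M X n B)
    (hPAB : PtDetermined R M X n (A ∩ B)) : PtDetermined R M X n (A ∪ B) := by
  refine ⟨fun i hi => isZero_of_forall_eq_zero R fun α => ?_, fun α hα => ?_⟩
  · refine eq_zero_of_res_union R M hA hB (hPAB.1 (i + 1) (by omega)) α ?_ ?_
    · haveI := ModuleCat.subsingleton_of_isZero (hPA.1 i hi); exact Subsingleton.elim _ _
    · haveI := ModuleCat.subsingleton_of_isZero (hPB.1 i hi); exact Subsingleton.elim _ _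
  · refine eq_zero_of_res_union R M hA hB (hPAB.1 (n + 1) (Nat.lt_succ_self n)) α ?_ ?_
    · refine hPA.2 _ fun x hx => ?_
      rw [← ModuleCat.comp_apply, res_comp_res]
      exact hα x (Or.inl hx)
    · refine hPB.2 _ fun x hx => ?_
      rw [← ModuleCat.comp_apply, res_comp_res]
      exact hα x (Or.inr hx)

/-- **Finite unions** (Lemma 3.27, steps (3)/(4), the inductions): if a class `Q` of closed sets is
stable under binary intersection and `P` holds on `Q`, then `P` holds for finite unions of members
of `Q`. [cite: HatcherAT2002, Lemma 3.27] -/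
theorem ptDetermined_biUnion {n : ℕ} {Q : Set X → Prop} (hQi : ∀ A B, Q A → Q B → Q (A ∩ B))
    (hQc : ∀ A, Q A → IsClosed A) (hQP : ∀ A, Q A → PtDetermined R M X n A) {ι : Type*}
    (t : Finset ι) :
    ∀ (F : ι → Set X), (∀ j ∈ t, Q (F j)) → PtDetermined R M X n (⋃ j ∈ t, F j) := by
  classical
  induction t using Finset.induction_on with
  | empty =>
    intro F _
    rw [show (⋃ j ∈ (∅ : Finset ι), F j) = ∅ by simp]
    exact ptDetermined_empty R M n
  | @insert a t ha ih =>
    intro F hF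
    rw [Finset.set_biUnion_insert]
    have hFa : Q (F a) := hF a (Finset.mem_insert_self a t)
    have hFt : ∀ j ∈ t, Q (F j) := fun j hj => hF j (Finset.mem_insert_of_mem hj)
    refine ptDetermined_union R M (hQc _ hFa)
      (isClosed_biUnion_finset fun j hj => hQc _ (hFt j hj)) (hQP _ hFa) (ih F hFt) ?_
    rw [Set.inter_iUnion₂]
    exact ih (fun j => F a ∩ F j) fun j hj => hQi _ _ hFa (hFt j hj)

/-! ### Transport of `P` along maps inducing isomorphisms on local homology -/

/-- Pulling `P` back along a map of pairs `f : (X, X ∖ A) → (Y, Y ∖ B)` that is injective near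
`A`, maps `A` onto `B` and induces monomorphisms `Hᵢ(X | A) → Hᵢ(Y | B)` for `i ≥ n` (used for
excision isomorphisms and homeomorphisms; Hatcher 2002, proof of Lemma 3.27 (4)). [folklore] -/
theorem PtDetermined.of_map {n : ℕ} {A : Set X} {B : Set Y} (f : C(X, Y))
    (hf : Set.MapsTo f Aᶜ Bᶜ) (hfx : ∀ x ∈ A, Set.MapsTo f ({x}ᶜ : Set X) ({f x}ᶜ : Set Y))
    (hBA : B ⊆ f '' A) (hmono : ∀ i, n ≤ i → Mono (map R M f hf i))
    (h : PtDetermined R M Y n B) : PtDetermined R M X n A := by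
  refine ⟨fun i hi => ?_, fun α hα => ?_⟩
  · haveI := hmono i hi.le
    exact Limits.IsZero.of_mono (map R M f hf i) (h.1 i hi)
  · haveI := hmono n le_rfl
    have hβ : map R M f hf n α = 0 := by
      refine h.2 _ fun y hy => ?_
      obtain ⟨x, hxA, rfl⟩ := hBA hy
      rw [← ModuleCat.comp_apply, map_comp_res R M f hf (hfx x hxA)
        (Set.singleton_subset_iff.mpr hxA) (Set.singleton_subset_iff.mpr hy) n,
        ModuleCat.comp_apply, hα x hxA, map_zero]
    exact (ModuleCat.mono_iff_injective _).mp inferInstance (hβ.trans (map_zero _).symm)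

/-- Pushing `P` forward along a map of pairs `f : (X, X ∖ A) → (Y, Y ∖ B)` with `f(A) ⊆ B` that
induces epimorphisms `Hᵢ(X | A) → Hᵢ(Y | B)` for `i ≥ n` and monomorphisms
`Hₙ(X | x) → Hₙ(Y | f x)` for `x ∈ A` (excision isomorphisms; Hatcher 2002, proof of
Lemma 3.27 (4)). [folklore] -/
theorem PtDetermined.map_of {n : ℕ} {A : Set X} {B : Set Y} (f : C(X, Y))
    (hf : Set.MapsTo f Aᶜ Bᶜ) (hfx : ∀ x ∈ A, Set.MapsTo f ({x}ᶜ : Set X) ({f x}ᶜ : Set Y))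
    (hAB : Set.MapsTo f A B) (hepi : ∀ i, n ≤ i → Epi (map R M f hf i))
    (hmono : ∀ (x : X) (hx : x ∈ A), Mono (map R M f (hfx x hx) n))
    (h : PtDetermined R M X n A) : PtDetermined R M Y n B := by
  refine ⟨fun i hi => ?_, fun β hβ => ?_⟩
  · haveI := hepi i hi.le
    exact Limits.IsZero.of_epi (map R M f hf i) (h.1 i hi)
  · haveI := hepi n le_rfl
    obtain ⟨α, rfl⟩ := (ModuleCat.epi_iff_surjective _).mp
      (inferInstance : Epi (map R M f hf n)) β
    have hα : α = 0 := h.2 α fun x hx => by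
      haveI := hmono x hx
      refine (ModuleCat.mono_iff_injective (map R M f (hfx x hx) n)).mp inferInstance ?_
      rw [map_zero, ← ModuleCat.comp_apply, ← map_comp_res R M f hf (hfx x hx)
        (Set.singleton_subset_iff.mpr hx) (Set.singleton_subset_iff.mpr (hAB hx)) n,
        ModuleCat.comp_apply]
      exact hβ (f x) (hAB hx)
    rw [hα, map_zero]

end clocalHomology

/-! ### `P(K)` for compact `K ⊆ ℝⁿ` (Lemma 3.27, steps (2) and (3)) -/

namespace clocalHomology

variable {n : ℕ}

/-- **Lemma 3.27 (2), bounded star-shaped sets**: `P(K)` holds for `K ⊆ ℝⁿ` bounded and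
star-shaped about a point of `K` (`n ≥ 1`). [cite: HatcherAT2002, Lemma 3.27] -/
theorem ptDetermined_of_starConvex (hn : 1 ≤ n) {K : Set (RVec n)} {x : RVec n}
    (hK : StarConvex ℝ x K) (hx : x ∈ K) (hKb : ∃ ρ : ℝ, ∀ v ∈ K, ‖v - x‖ < ρ) :
    PtDetermined R M (RVec n) n K := by
  refine ⟨fun i hi => isZero_of_starConvex R M hK hx hKb hn hi, fun α hα => ?_⟩
  haveI := isIso_res_singleton_of_starConvex R M hK hx hKb n
  exact (ModuleCat.mono_iff_injective (res R M (RVec n) (Set.singleton_subset_iff.mpr hx)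
    n)).mp inferInstance ((hα x hx).trans (map_zero _).symm)

/-- **Lemma 3.27 (2)**: `P(K)` holds for compact convex `K ⊆ ℝⁿ` (`n ≥ 1`).
[cite: HatcherAT2002, Lemma 3.27] -/
theorem ptDetermined_of_convex (hn : 1 ≤ n) {K : Set (RVec n)} (hKc : IsCompact K)
    (hK : Convex ℝ K) : PtDetermined R M (RVec n) n K := by
  rcases K.eq_empty_or_nonempty with rfl | ⟨x, hx⟩
  · exact ptDetermined_empty R M n
  · exact ptDetermined_of_starConvex R M hn (hK.starConvex hx) hx (exists_forall_norm_sub_lt hKc x)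

/-- **Lemma 3.27 (3), finite unions of compact convex sets** in `ℝⁿ` satisfy `P` (`n ≥ 1`).
[cite: HatcherAT2002, Lemma 3.27] -/
theorem ptDetermined_biUnion_convex (hn : 1 ≤ n) {ι : Type*} (t : Finset ι)
    (F : ι → Set (RVec n)) (hc : ∀ j ∈ t, IsCompact (F j)) (hconv : ∀ j ∈ t, Convex ℝ (F j)) :
    PtDetermined R M (RVec n) n (⋃ j ∈ t, F j) :=
  ptDetermined_biUnion R M (Q := fun A => IsCompact A ∧ Convex ℝ A)
    (fun _ _ hA hB => ⟨hA.1.inter_right hB.1.isClosed, hA.2.inter hB.2⟩) (fun _ hA => hA.1.isClosed)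
    (fun _ hA => ptDetermined_of_convex R M hn hA.1 hA.2) t F fun j hj => ⟨hc j hj, hconv j hj⟩

/-- **Lemma 3.27 (3), the approximation step**: a class in `Hᵢ(ℝⁿ | K)`, `K` compact, is the
restriction of a class in `Hᵢ(ℝⁿ | K')` for a finite union `K' ⊇ K` of closed balls of a common
radius centred in `K` (a representing relative cycle `z` has `∂z` supported at positive distance
from `K`). [cite: HatcherAT2002, Lemma 3.27] -/
lemma exists_res_ballUnion_eq {K : Set (RVec n)} (hK : IsCompact K) {i : ℕ}
    (α : clocalHomology R M (RVec n) K i) :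
    ∃ (δ : ℝ) (_ : 0 < δ) (t : Finset K) (hKt : K ⊆ ⋃ a ∈ t, Metric.closedBall (a : RVec n) δ)
      (α' : clocalHomology R M (RVec n) (⋃ a ∈ t, Metric.closedBall (a : RVec n) δ) i),
      res R M (RVec n) hKt i α' = α := by
  obtain ⟨z, hz, rfl⟩ := (awaySub R M (RVec n) K).relCls_surjective α
  -- the carrier `L` of `∂z` is a compact set disjoint from `K`
  set L : Set (RVec n) := CChain.carrier (M := M) (X := RVec n) (n := (ComplexShape.down ℕ).next i)
    ((csingularChainComplex R M (RVec n)).d i ((ComplexShape.down ℕ).next i) z) with hL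
  have hLc : IsCompact L := CChain.isCompact_carrier _
  have hzL : CChain.carrier (M := M) (X := RVec n) (n := (ComplexShape.down ℕ).next i)
      ((csingularChainComplex R M (RVec n)).d i ((ComplexShape.down ℕ).next i) z) ⊆ Kᶜ :=
    (CChain.mem_chainsIn_iff_carrier_subset R _).mp hz
  have hKL : K ⊆ Lᶜ := Set.subset_compl_comm.mp hzL
  obtain ⟨δ, hδ, hthick⟩ := hK.exists_cthickening_subset_open hLc.isClosed.isOpen_compl hKL
  obtain ⟨t, ht⟩ := hK.elim_finite_subcover (fun a : K => Metric.ball (a : RVec n) δ)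
    (fun _ => Metric.isOpen_ball) fun x hx => Set.mem_iUnion.mpr ⟨⟨x, hx⟩, Metric.mem_ball_self hδ⟩
  have hKt : K ⊆ ⋃ a ∈ t, Metric.closedBall (a : RVec n) δ :=
    ht.trans (Set.iUnion₂_mono fun a _ => Metric.ball_subset_closedBall)
  have hK'L : (⋃ a ∈ t, Metric.closedBall (a : RVec n) δ) ⊆ Lᶜ :=
    (Set.iUnion₂_subset fun a _ => Metric.closedBall_subset_cthickening a.2 δ).trans hthick
  have hz' : (csingularChainComplex R M (RVec n)).d i ((ComplexShape.down ℕ).next i) z ∈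
      awaySub R M (RVec n) (⋃ a ∈ t, Metric.closedBall (a : RVec n) δ)
        ((ComplexShape.down ℕ).next i) := by
    change _ ∈ chainsIn R M (RVec n) _ _
    rw [CChain.mem_chainsIn_iff_carrier_subset]
    exact Set.subset_compl_comm.mp hK'L
  refine ⟨δ, hδ, t, hKt, (awaySub R M (RVec n) _).relCls z hz', ?_⟩
  rw [res_eq, Subcomplex.homologyMap_quotientMap_relCls]

/-- **Lemma 3.27 (3)**: `P(K)` holds for every compact `K ⊆ ℝⁿ` (`n ≥ 1`).
[cite: HatcherAT2002, Lemma 3.27] -/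
theorem ptDetermined_of_isCompact_rvec (hn : 1 ≤ n) {K : Set (RVec n)} (hK : IsCompact K) :
    PtDetermined R M (RVec n) n K := by
  have hballs : ∀ (δ : ℝ) (t : Finset K),
      PtDetermined R M (RVec n) n (⋃ a ∈ t, Metric.closedBall (a : RVec n) δ) := fun δ t =>
    ptDetermined_biUnion_convex R M hn t (fun a : K => Metric.closedBall (a : RVec n) δ)
      (fun a _ => isCompact_closedBall _ _) (fun a _ => convex_closedBall _ _)
  refine ⟨fun i hi => isZero_of_forall_eq_zero R fun α => ?_, fun α hα => ?_⟩
  · obtain ⟨δ, hδ, t, hKt, α', rfl⟩ := exists_res_ballUnion_eq R M hK α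
    haveI := ModuleCat.subsingleton_of_isZero ((hballs δ t).1 i hi)
    rw [Subsingleton.elim α' 0, map_zero]
  · obtain ⟨δ, hδ, t, hKt, α', rfl⟩ := exists_res_ballUnion_eq R M hK α
    suffices h : α' = 0 by rw [h, map_zero]
    refine (hballs δ t).2 α' fun y hy => ?_
    obtain ⟨a, ha, hya⟩ := Set.mem_iUnion₂.mp hy
    have hB : Metric.closedBall (a : RVec n) δ ⊆ ⋃ a ∈ t, Metric.closedBall (a : RVec n) δ :=
      Set.subset_iUnion₂ (s := fun (a : K) (_ : a ∈ t) => Metric.closedBall (a : RVec n) δ) a ha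
    have haB : (a : RVec n) ∈ Metric.closedBall (a : RVec n) δ := Metric.mem_closedBall_self hδ.le
    haveI := isIso_res_singleton_of_starConvex R M
      ((convex_closedBall (a : RVec n) δ).starConvex haB) haB
      (exists_forall_norm_sub_lt (isCompact_closedBall _ _) _) n
    -- `β := res_{K' → B} α'` vanishes since its restriction to the centre `a ∈ K` does
    have hβ : res R M (RVec n) hB n α' = 0 := by
      refine (ModuleCat.mono_iff_injective (res R M (RVec n)
        (Set.singleton_subset_iff.mpr haB) n)).mp inferInstance ?_
      rw [map_zero, ← ModuleCat.comp_apply, res_comp_res]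
      have h := hα a a.2
      rw [← ModuleCat.comp_apply, res_comp_res] at h
      exact h
    rw [← res_comp_res R M hB (Set.singleton_subset_iff.mpr hya), ModuleCat.comp_apply, hβ,
      map_zero]

end clocalHomology

end Literature.AlgebraicTopology.SingularHomology

end

/-!
## Part B — Lemma 3.27 (4) on manifolds and Prop. 3.29 (top homology of non-compact manifolds)

Hatcher 2002, §3.3, Lemma 3.27 (4) (p. 236) and Prop. 3.29 (p. 239), on top of Part A; see the
module docstring.
-/

noncomputable section

-- as in `SingularChainsConcrete`: chains of the concrete complex are `Finsupp`s up to unfolding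
set_option backward.isDefEq.respectTransparency false

open CategoryTheory Limits Topology

universe u v w

namespace Literature.AlgebraicTopology.SingularHomology

/-! ### Two small pieces of category theory and an index adapter -/

section Squares

variable {C : Type*} [Category C] {A B A' B' : C}

/-- In a commuting square `f ≫ r' = r ≫ g` with `f` and `r'` monomorphisms, `r` is a
monomorphism. [folklore] -/
lemma mono_of_sq {f : A ⟶ B} {r : A ⟶ A'} {r' : B ⟶ B'} {g : A' ⟶ B'} (sq : f ≫ r' = r ≫ g)
    [Mono f] [Mono r'] : Mono r := by
  haveI : Mono (r ≫ g) := by rw [← sq]; infer_instance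
  exact mono_of_mono r g

/-- In a commuting square `f ≫ r' = r ≫ g` with `f` an isomorphism and `r`, `g` monomorphisms,
`r'` is a monomorphism. [folklore] -/
lemma mono_of_sq' {f : A ⟶ B} {r : A ⟶ A'} {r' : B ⟶ B'} {g : A' ⟶ B'} (sq : f ≫ r' = r ≫ g)
    [IsIso f] [Mono r] [Mono g] : Mono r' := by
  have e : r' = inv f ≫ r ≫ g := by rw [← sq, IsIso.inv_hom_id_assoc]
  rw [e]
  infer_instance

end Squares

section Adapters

variable {R : Type v} [CommRing R] {ι : Type*} {c : ComplexShape ι}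
variable {K : HomologicalComplex (ModuleCat.{w} R) c}

/-- "Boundary modulo a submodule" from `c.prev j` is the same from any `i` with `c.prev j = i`.
[folklore] -/
lemma exists_d_prev_sub_mem_iff {i j : ι} (h : c.prev j = i) (z : K.X j)
    (N : Submodule R (K.X j)) :
    (∃ w : K.X (c.prev j), K.d (c.prev j) j w - z ∈ N) ↔ ∃ w : K.X i, K.d i j w - z ∈ N := by
  subst h
  rfl

end Adapters

section General

variable (R : Type v) [CommRing R] (M : Type v) [AddCommGroup M] [Module R M]
variable {X : Type u} [TopologicalSpace X]

/-! ### Chains in disjoint open sets -/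

/-- A chain with image in the union of two disjoint open sets splits as a chain in the first plus
a chain in the second (every singular simplex has connected image). [folklore] -/
lemma chainsIn_union_le_sup {U V : Set X} (hU : IsOpen U) (hV : IsOpen V) (hUV : Disjoint U V)
    (m : ℕ) : chainsIn R M X (U ∪ V) m ≤ chainsIn R M X U m ⊔ chainsIn R M X V m := by
  classical
  intro c hc
  rw [mem_chainsIn_iff] at hc
  rw [← Finsupp.filter_add_filter_not c (fun σ : SingularSimplex X m => σ.range ⊆ U)]
  refine Submodule.add_mem_sup ?_ ?_
  · rw [mem_chainsIn_iff]
    intro σ hσ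
    rw [Finsupp.support_filter, Finset.mem_filter] at hσ
    exact hσ.2
  · rw [mem_chainsIn_iff]
    intro σ hσ
    rw [Finsupp.support_filter, Finset.mem_filter] at hσ
    have hpre : IsPreconnected σ.range := by
      haveI : PreconnectedSpace (stdSimplex ℝ (Fin (m + 1))) :=
        isPreconnected_iff_preconnectedSpace.mp (convex_stdSimplex ℝ (Fin (m + 1))).isPreconnected
      exact isPreconnected_range (SingularSimplex.toContinuousMap σ).continuous
    rcases hpre.subset_or_subset hU hV hUV (hc σ hσ.1) with h | h
    · exact absurd h hσ.2
    · exact h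

/-- There are no chains in the empty subspace: `Cₘ(∅) = 0`. [folklore] -/
lemma chainsIn_empty (m : ℕ) : chainsIn R M X (∅ : Set X) m = ⊥ := by
  refine (Submodule.eq_bot_iff _).mpr fun c hc => ?_
  rw [mem_chainsIn_iff] at hc
  rw [← Finsupp.support_eq_empty, Finset.eq_empty_iff_forall_notMem]
  intro σ hσ
  exact Set.not_nonempty_empty ((σ.range_nonempty).mono (hc σ hσ))

/-- A cycle is a relative cycle modulo every subcomplex, in every target degree. [folklore] -/
lemma clocalHomology.d_mem_awaySub_of_cycle {i : ℕ} {z : (csingularChainComplex R M X).X i}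
    (hz : (csingularChainComplex R M X).d i ((ComplexShape.down ℕ).next i) z = 0) (A : Set X)
    (j : ℕ) : (csingularChainComplex R M X).d i j z ∈ awaySub R M X A j := by
  by_cases hij : (ComplexShape.down ℕ).Rel i j
  · rw [← (ComplexShape.down ℕ).next_eq' hij, hz]
    exact Submodule.zero_mem _
  · rw [(csingularChainComplex R M X).shape i j hij]
    exact Submodule.zero_mem _

end General

/-!
### Manifolds

From here on the space `X` lives in `Type` (universe `0`): the Euclidean charts are valued in
`ℝⁿ : Type`, and the functoriality `Literature.AlgebraicTopology.SingularHomology.clocalHomology.map` of local homology is only available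
for spaces in a common universe. This is exactly the generality consumed by
`Literature.Topology.FourManifolds.compactSpace_of_homotopyEquiv_sphere_four_of_facts`.
-/

section Manifold

variable (R : Type v) [CommRing R] (M : Type v) [AddCommGroup M] [Module R M]
variable {X : Type} [TopologicalSpace X] [T2Space X]

namespace clocalHomology

/-! ### Lemma 3.27 (4): compact sets in a manifold -/

/-- **Lemma 3.27 (4), compact sets inside a Euclidean chart**: if `K` is compact and contained
in the source of an open partial homeomorphism `e : X ⇀ ℝⁿ` (`n ≥ 1`, `X` Hausdorff), then `P(K)`
holds: by excision `H(X | K) ≅ H(e.source | K) ≅ H(e.target | e(K)) ≅ H(ℝⁿ | e(K))`, compatibly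
with restriction to points. [cite: HatcherAT2002, Lemma 3.27] -/
theorem ptDetermined_of_subset_source {n : ℕ} (hn : 1 ≤ n) (e : OpenPartialHomeomorph X (RVec n))
    {K : Set X} (hK : IsCompact K) (hKe : K ⊆ e.source) : PtDetermined R M X n K := by
  -- (0) the image `e(K) ⊆ ℝⁿ`
  have hK''c : IsCompact (e '' K) := hK.image_of_continuousOn (e.continuousOn.mono hKe)
  have hK''t : e '' K ⊆ e.target := by
    rintro _ ⟨x, hx, rfl⟩
    exact e.map_source (hKe hx)
  have h₀ : PtDetermined R M (RVec n) n (e '' K) := ptDetermined_of_isCompact_rvec R M hn hK''c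
  -- (1) excision `ℝⁿ ⊇ e.target`
  have h₁ : PtDetermined R M (↥e.target) n (Subtype.val ⁻¹' (e '' K)) := by
    refine h₀.of_map R M (⟨Subtype.val, continuous_subtype_val⟩ : C(↥e.target, RVec n))
      (fun x hx => hx) (fun x _ y hy h => hy (Subtype.ext h)) ?_ ?_
    · intro y hy
      exact ⟨⟨y, hK''t hy⟩, hy, rfl⟩
    · intro i _
      haveI := isIso_map_val R M (X := RVec n) rfl e.open_target hK''c.isClosed hK''t
        (fun x hx => hx) i
      infer_instance
  -- (2) the homeomorphism `e.source ≃ₜ e.target`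
  have hpre : e.toHomeomorphSourceTarget ⁻¹' (Subtype.val ⁻¹' (e '' K)) = Subtype.val ⁻¹' K := by
    ext x
    exact e.injOn.mem_image_iff hKe x.2
  have h₂ : PtDetermined R M (↥e.source) n (Subtype.val ⁻¹' K) := by
    refine h₁.of_map R M (e.toHomeomorphSourceTarget : C(↥e.source, ↥e.target))
      (fun x hx hB => hx (by rw [← hpre]; exact hB))
      (fun x _ y hy h => hy (e.toHomeomorphSourceTarget.injective h)) ?_ ?_
    · intro y hy
      refine ⟨e.toHomeomorphSourceTarget.symm y, ?_, e.toHomeomorphSourceTarget.apply_symm_apply y⟩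
      rw [← hpre, Set.mem_preimage, e.toHomeomorphSourceTarget.apply_symm_apply]
      exact hy
    · intro i _
      haveI := isIso_map_homeomorph R M e.toHomeomorphSourceTarget hpre i
      infer_instance
  -- (3) excision `e.source ⊆ X`
  refine h₂.map_of R M (⟨Subtype.val, continuous_subtype_val⟩ : C(↥e.source, X))
    (fun x hx => hx) (fun x _ y hy h => hy (Subtype.ext h)) (Set.mapsTo_preimage _ _)
    ?_ ?_
  · intro i _
    haveI := isIso_map_val R M (X := X) rfl e.open_source hK.isClosed hKe (fun x hx => hx) i
    infer_instance
  · intro x hx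
    haveI := isIso_map_val R M (X := X) (A := {(x : X)}) (A' := {x})
      (by ext y; simp [Subtype.ext_iff]) e.open_source isClosed_singleton
      (Set.singleton_subset_iff.mpr x.2) (fun y hy h => hy (Subtype.ext h)) n
    infer_instance

variable {n : ℕ} [ChartedSpace (EuclideanSpace ℝ (Fin n)) X]

omit [T2Space X] in
variable (X n) in
/-- Every point of a manifold modelled on `EuclideanSpace ℝ (Fin n)` lies in the source of a chart
re-targeted to `ℝⁿ = (Fin n → ℝ)` (through `EuclideanSpace ℝ (Fin n) ≃L[ℝ] (Fin n → ℝ)`). [folklore] -/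
lemma exists_mem_source_rvec (a : X) : ∃ e : OpenPartialHomeomorph X (RVec n), a ∈ e.source :=
  ⟨(chartAt (EuclideanSpace ℝ (Fin n)) a).transHomeomorph (coords n).toHomeomorph, by
    rw [OpenPartialHomeomorph.transHomeomorph_source]
    exact mem_chart_source _ a⟩

/-- **Lemma 3.27 for manifolds** (parts (b) and the uniqueness half of (a)): for a compact subset
`K` of a Hausdorff topological `n`-manifold (`n ≥ 1`), `Hᵢ(X | K; M) = 0` for `i > n`, and a
class in `Hₙ(X | K; M)` with vanishing restriction to every `Hₙ(X | x; M)`, `x ∈ K`, is zero.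
Proof: `K` is a finite union of compact sets each inside a Euclidean chart (local compactness),
and step (1) (relative Mayer–Vietoris induction). [cite: HatcherAT2002, Lemma 3.27] -/
theorem ptDetermined_of_isCompact (hn : 1 ≤ n) {K : Set X} (hK : IsCompact K) :
    PtDetermined R M X n K := by
  haveI : LocallyCompactSpace X := ChartedSpace.locallyCompactSpace (EuclideanSpace ℝ (Fin n)) X
  choose c hc using exists_mem_source_rvec X n
  have hN : ∀ a : X, ∃ N : Set X, IsCompact N ∧ a ∈ interior N ∧ N ⊆ (c a).source :=
    fun a => exists_compact_subset (c a).open_source (hc a)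
  choose N hNc hNa hNs using hN
  obtain ⟨t, ht⟩ := hK.elim_finite_subcover (fun a => interior (N a)) (fun _ => isOpen_interior)
    fun a _ => Set.mem_iUnion.mpr ⟨a, hNa a⟩
  have hKeq : K = ⋃ a ∈ t, K ∩ N a := by
    apply le_antisymm
    · intro x hx
      obtain ⟨a, ha, hxa⟩ := Set.mem_iUnion₂.mp (ht hx)
      exact Set.mem_iUnion₂.mpr ⟨a, ha, hx, interior_subset hxa⟩
    · exact Set.iUnion₂_subset fun a _ => Set.inter_subset_left
  rw [hKeq]
  exact ptDetermined_biUnion R M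
    (Q := fun A => IsCompact A ∧ ∃ e : OpenPartialHomeomorph X (RVec n), A ⊆ e.source)
    (fun A B hA hB => ⟨hA.1.inter_right hB.1.isClosed,
      hA.2.imp fun e he => Set.inter_subset_left.trans he⟩)
    (fun A hA => hA.1.isClosed)
    (fun A hA => hA.2.elim fun e he => ptDetermined_of_subset_source R M hn e hA.1 he) t
    (fun a => K ∩ N a) fun a _ =>
      ⟨hK.inter_right (hNc a).isClosed, c a, Set.inter_subset_right.trans (hNs a)⟩

/-! ### Local constancy of `x ↦ Hₙ(X | x)` -/

variable (n) in
/-- **Local homology is locally constant on a manifold** (Hatcher 2002, §3.3, pp. 234–236: the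
maps `Hₙ(X | B) → Hₙ(X | y)` are isomorphisms for `y` in a ball `B`): every point `x` of a Hausdorff
`n`-manifold has a neighbourhood `W` and a set `B ⊇ W` such that the restriction
`Hₙ(X | B; M) → Hₙ(X | y; M)` is a monomorphism for every `y ∈ W` (`B`, `W` the inverse images of a
closed and an open ball in a chart; excision and the star-shaped computation in `ℝⁿ`).
[cite: HatcherAT2002, Lemma 3.27] -/
theorem exists_nhds_res_mono (x : X) :
    ∃ (B W : Set X), W ∈ 𝓝 x ∧ ∃ hWB : W ⊆ B,
      ∀ (y : X) (hy : y ∈ W), Mono (res R M X (Set.singleton_subset_iff.mpr (hWB hy)) n) := by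
  obtain ⟨e, hxe⟩ := exists_mem_source_rvec X n x
  obtain ⟨r, hr, hrt⟩ := Metric.isOpen_iff.mp e.open_target (e x) (e.map_source hxe)
  set B' := Metric.closedBall (e x) (r / 2) with hB'
  set W' := Metric.ball (e x) (r / 2) with hW'
  have hB't : B' ⊆ e.target := (Metric.closedBall_subset_ball (half_lt_self hr)).trans hrt
  have hW'B' : W' ⊆ B' := Metric.ball_subset_closedBall
  set B := e.source ∩ e ⁻¹' B' with hB
  set W := e.source ∩ e ⁻¹' W' with hW
  have hWo : IsOpen W := e.isOpen_inter_preimage Metric.isOpen_ball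
  have hxW : x ∈ W := ⟨hxe, Metric.mem_ball_self (half_pos hr)⟩
  have hWB : W ⊆ B := fun y hy => ⟨hy.1, hW'B' hy.2⟩
  have hBc : IsCompact B := by
    rw [hB, ← e.symm_image_eq_source_inter_preimage hB't]
    exact (isCompact_closedBall _ _).image_of_continuousOn (e.continuousOn_symm.mono hB't)
  have hBe : B ⊆ e.source := Set.inter_subset_left
  refine ⟨B, W, hWo.mem_nhds hxW, hWB, fun y hy => ?_⟩
  have hye : y ∈ e.source := hy.1
  have hyB' : e y ∈ B' := hW'B' hy.2
  -- (ℝⁿ) `res : H(ℝⁿ | B') → H(ℝⁿ | e y)` is an isomorphism (`B'` is star-shaped about `e y`)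
  haveI i0 : IsIso (res R M (RVec n) (Set.singleton_subset_iff.mpr hyB') n) :=
    isIso_res_singleton_of_starConvex R M ((convex_closedBall _ _).starConvex hyB') hyB'
      (exists_forall_norm_sub_lt (isCompact_closedBall _ _) _) n
  -- (`e.target`) by excision
  let yₜ : ↥e.target := ⟨e y, e.map_source hye⟩
  have m1 : Mono (res R M (↥e.target) (A := Subtype.val ⁻¹' B') (B := {yₜ})
      (Set.singleton_subset_iff.mpr hyB') n) := by
    have sq := map_comp_res R M (X := ↥e.target) (Y := RVec n)
      (⟨Subtype.val, continuous_subtype_val⟩ : C(↥e.target, RVec n))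
      (A := Subtype.val ⁻¹' B') (B := B') (A' := {yₜ}) (B' := {e y})
      (fun z hz => hz) (fun z hz h => hz (Subtype.ext h))
      (Set.singleton_subset_iff.mpr hyB') (Set.singleton_subset_iff.mpr hyB') n
    haveI := isIso_map_val R M (X := RVec n) rfl e.open_target
      (isCompact_closedBall _ _).isClosed hB't (fun z hz => hz) n
    exact mono_of_sq sq
  -- (`e.source`) by the homeomorphism `e.source ≃ₜ e.target`
  let φ : ↥e.source ≃ₜ ↥e.target := e.toHomeomorphSourceTarget
  let yₛ : ↥e.source := ⟨y, hye⟩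
  have hφy : φ yₛ = yₜ := Subtype.ext rfl
  have hpre : φ ⁻¹' (Subtype.val ⁻¹' B') = Subtype.val ⁻¹' B := by
    ext z
    exact ⟨fun h => ⟨z.2, h⟩, fun h => h.2⟩
  have hyB : (yₛ : X) ∈ B := ⟨hye, hyB'⟩
  have m2 : Mono (res R M (↥e.source) (A := Subtype.val ⁻¹' B) (B := {yₛ})
      (Set.singleton_subset_iff.mpr hyB) n) := by
    have hφ' : ∀ z : ↥e.source, z ∈ ({yₛ}ᶜ : Set ↥e.source) → φ z ∈ ({yₜ}ᶜ : Set ↥e.target) :=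
      fun z hz h => hz (φ.injective (h.trans hφy.symm))
    have sq := map_comp_res R M (X := ↥e.source) (Y := ↥e.target) (φ : C(↥e.source, ↥e.target))
      (A := Subtype.val ⁻¹' B) (B := Subtype.val ⁻¹' B') (A' := {yₛ}) (B' := {yₜ})
      (fun z hz hB => hz (by rw [← hpre]; exact hB)) hφ'
      (Set.singleton_subset_iff.mpr hyB) (Set.singleton_subset_iff.mpr hyB') n
    haveI := isIso_map_homeomorph R M φ hpre n
    haveI := m1
    exact mono_of_sq sq
  -- (`X`) by excision
  have sq := map_comp_res R M (X := ↥e.source) (Y := X)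
    (⟨Subtype.val, continuous_subtype_val⟩ : C(↥e.source, X))
    (A := Subtype.val ⁻¹' B) (B := B) (A' := {yₛ}) (B' := {y})
    (fun z hz => hz) (fun z hz h => hz (Subtype.ext h))
    (Set.singleton_subset_iff.mpr hyB) (Set.singleton_subset_iff.mpr (hWB hy)) n
  haveI := isIso_map_val R M (X := X) rfl e.open_source hBc.isClosed hBe (fun z hz => hz) n
  haveI := isIso_map_val R M (X := X) (A := {y}) (A' := {yₛ}) (by ext z; simp [yₛ, Subtype.ext_iff])
    e.open_source isClosed_singleton (Set.singleton_subset_iff.mpr hye)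
    (fun z hz h => hz (Subtype.ext h)) n
  haveI := m2
  exact mono_of_sq' sq

/-! ### Prop. 3.29 -/

/-- On a connected non-compact `n`-manifold, the image of any `n`-cycle `z` in
`Hₙ(X | x; M)` vanishes for every point `x`: the set of such `x` is open and closed by local
constancy (`exists_nhds_res_mono`) and contains every point outside the (compact, hence proper)
carrier of `z` (Hatcher 2002, proof of Prop. 3.29: "the section `x ↦ [z]ₓ` is zero").
[cite: HatcherAT2002, Prop. 3.29] -/
theorem relCls_singleton_eq_zero [ConnectedSpace X] [NoncompactSpace X]
    (z : (csingularChainComplex R M X).X n)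
    (hz : (csingularChainComplex R M X).d n ((ComplexShape.down ℕ).next n) z = 0) (x : X) :
    (awaySub R M X {x}).relCls z (d_mem_awaySub_of_cycle R M hz {x} _) = 0 := by
  -- the vanishing set `Z`
  let Z : Set X := {x | (awaySub R M X {x}).relCls z (d_mem_awaySub_of_cycle R M hz {x} _) = 0}
  -- restriction from `H(X | B)` to a point `y ∈ B` sends the class of `z` to the class of `z`
  have hres : ∀ (B : Set X) (y : X) (hy : y ∈ B),
      res R M X (Set.singleton_subset_iff.mpr hy) n
        ((awaySub R M X B).relCls z (d_mem_awaySub_of_cycle R M hz B _)) =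
        (awaySub R M X {y}).relCls z (d_mem_awaySub_of_cycle R M hz {y} _) := fun B y hy => by
    rw [res_eq, Subcomplex.homologyMap_quotientMap_relCls]
  -- `Z` is nonempty: a point outside the carrier of `z`
  have hne : Z.Nonempty := by
    obtain ⟨x₀, hx₀⟩ := (Set.ne_univ_iff_exists_notMem _).mp
      (CChain.isCompact_carrier (M := M) (X := X) (n := n) z).ne_univ
    refine ⟨x₀, (Subcomplex.relCls_eq_zero_iff _ _ _).mpr ⟨0, ?_⟩⟩
    rw [map_zero, zero_sub]
    exact Submodule.neg_mem _ (chainsIn_mono R M (Set.subset_compl_singleton_iff.mpr hx₀) n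
      (CChain.mem_chainsIn_carrier R z))
  -- `Z` is open and closed
  have hZo : IsOpen Z := by
    refine isOpen_iff_mem_nhds.mpr fun x hx => ?_
    obtain ⟨B, W, hW, hWB, hmono⟩ := exists_nhds_res_mono R M n x
    have hxW : x ∈ W := mem_of_mem_nhds hW
    have hB : (awaySub R M X B).relCls z (d_mem_awaySub_of_cycle R M hz B _) = 0 := by
      haveI := hmono x hxW
      refine (ModuleCat.mono_iff_injective
        (res R M X (Set.singleton_subset_iff.mpr (hWB hxW)) n)).mp inferInstance ?_
      rw [map_zero, hres B x (hWB hxW)]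
      exact hx
    refine Filter.mem_of_superset hW fun y hy => ?_
    change (awaySub R M X {y}).relCls z _ = 0
    rw [← hres B y (hWB hy), hB, map_zero]
  have hZc : IsClosed Z := by
    refine isOpen_compl_iff.mp (isOpen_iff_mem_nhds.mpr fun x hx => ?_)
    obtain ⟨B, W, hW, hWB, hmono⟩ := exists_nhds_res_mono R M n x
    have hxW : x ∈ W := mem_of_mem_nhds hW
    have hB : (awaySub R M X B).relCls z (d_mem_awaySub_of_cycle R M hz B _) ≠ 0 := by
      intro hB
      apply hx
      change (awaySub R M X {x}).relCls z _ = 0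
      rw [← hres B x (hWB hxW), hB, map_zero]
    refine Filter.mem_of_superset hW fun y hy hy0 => hB ?_
    haveI := hmono y hy
    refine (ModuleCat.mono_iff_injective
      (res R M X (Set.singleton_subset_iff.mpr (hWB hy)) n)).mp inferInstance ?_
    rw [map_zero, hres B y (hWB hy)]
    exact hy0
  have hZ : Z = Set.univ := IsClopen.eq_univ ⟨hZc, hZo⟩ hne
  exact (Set.eq_univ_iff_forall.mp hZ x : x ∈ Z)

/-- **Hatcher Prop. 3.29 in the concrete model, all coefficients, `n ≥ 1`.** If `X` is a connected,
non-compact, Hausdorff topological `n`-manifold with `n ≥ 1`, then `Hᵢ(X; M) = 0` for all `i ≥ n`.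
Proof (Hatcher p. 239, with the long exact sequence of the triple replaced by the equivalent
chain-level bookkeeping): a cycle `z` has compact carrier `|z| ⊆ U` with `U` open, `Ū` compact;
its class in `Hᵢ(X | Ū)` vanishes (for `i > n` by Lemma 3.27 (b), for `i = n` by
`relCls_singleton_eq_zero` and Lemma 3.27 (a)), so `z = ∂w + v` with `v` a chain in `V = X ∖ Ū`;
then `w` is a cycle modulo `C(U ∪ V) = C(X ∖ (Ū ∖ U))` and `Hᵢ₊₁(X | Ū ∖ U) = 0` (Lemma 3.27 (b))
gives `w = ∂y + c` with `c` a chain in `U ∪ V`; splitting `c = c_U + c_V` (`U`, `V` disjoint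
open) yields `z + ∂c_U ∈ C(U) ∩ C(V) = 0`. [cite: HatcherAT2002, Prop. 3.29] -/
theorem isZero_csingularHomology_of_noncompact_of_pos [ConnectedSpace X] [NoncompactSpace X]
    (hn : 1 ≤ n) {i : ℕ} (hi : n ≤ i) : IsZero (csingularHomology R M X i) := by
  haveI : LocallyCompactSpace X := ChartedSpace.locallyCompactSpace (EuclideanSpace ℝ (Fin n)) X
  refine isZero_of_forall_eq_zero R fun a => ?_
  obtain ⟨z, hz, rfl⟩ := homologyCls_surjective a
  -- the carrier of `z`, a relatively compact open neighbourhood `U`, `Kc = Ū`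
  have hLc : IsCompact (CChain.carrier (M := M) (X := X) (n := i) z) := CChain.isCompact_carrier _
  have hzL : z ∈ chainsIn R M X (CChain.carrier (M := M) (X := X) (n := i) z) i :=
    CChain.mem_chainsIn_carrier R _
  obtain ⟨U, hUo, hLU, hUc⟩ := exists_isOpen_superset_and_isCompact_closure hLc
  have hUK : U ⊆ closure U := subset_closure
  have hzU : z ∈ chainsIn R M X U i := chainsIn_mono R M hLU i hzL
  -- Step A: the class of `z` in `Hᵢ(X | Ū)` vanishes
  have stepA : (awaySub R M X (closure U)).relCls z (d_mem_awaySub_of_cycle R M hz _ _) = 0 := by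
    rcases hi.lt_or_eq with hlt | heq
    · haveI := ModuleCat.subsingleton_of_isZero ((ptDetermined_of_isCompact R M hn hUc).1 i hlt)
      exact Subsingleton.elim _ _
    · subst heq
      refine (ptDetermined_of_isCompact R M hn hUc).2 _ fun x _ => ?_
      rw [res_eq, Subcomplex.homologyMap_quotientMap_relCls]
      exact relCls_singleton_eq_zero R M z hz x
  -- Step B: `z = ∂w - v`, `v` a chain in `V = X ∖ Ū`
  obtain ⟨w, hw⟩ : ∃ w : (csingularChainComplex R M X).X (i + 1), (csingularChainComplex R M X).d (i + 1) i w - z ∈ awaySub R M X (closure U) i :=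
    (exists_d_prev_sub_mem_iff (ChainComplex.prev ℕ i) z _).mp
      (((awaySub R M X (closure U)).relCls_eq_zero_iff z _).mp stepA)
  have hv : (csingularChainComplex R M X).d (i + 1) i w - z ∈ chainsIn R M X (closure U)ᶜ i := hw
  -- `∂w ∈ C(U ∪ V)`, so `w` is a cycle modulo `C(X ∖ K₂)`, `K₂ = Ū ∖ U` compact
  have hUV : U ∪ (closure U)ᶜ ⊆ (closure U ∩ Uᶜ)ᶜ := fun x hx hK₂ =>
    hx.elim (fun hU => hK₂.2 hU) (fun hV => hV hK₂.1)
  have hVU : (closure U ∩ Uᶜ)ᶜ ⊆ U ∪ (closure U)ᶜ := fun x hx => by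
    by_contra h
    simp only [Set.mem_union, Set.mem_compl_iff, not_or, not_not] at h
    exact hx ⟨h.2, h.1⟩
  have hK₂c : IsCompact (closure U ∩ Uᶜ) := hUc.inter_right hUo.isClosed_compl
  have hdw : (csingularChainComplex R M X).d (i + 1) i w ∈ chainsIn R M X (U ∪ (closure U)ᶜ) i := by
    rw [← sub_add_cancel ((csingularChainComplex R M X).d (i + 1) i w) z]
    exact Submodule.add_mem _ (chainsIn_mono R M Set.subset_union_right i hv)
      (chainsIn_mono R M Set.subset_union_left i hzU)
  have hw₂ : ∀ j, (csingularChainComplex R M X).d (i + 1) j w ∈ awaySub R M X (closure U ∩ Uᶜ) j := by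
    intro j
    by_cases hij : (ComplexShape.down ℕ).Rel (i + 1) j
    · obtain rfl : j = i := by change j + 1 = i + 1 at hij; omega
      exact chainsIn_mono R M hUV j hdw
    · rw [(csingularChainComplex R M X).shape _ _ hij]
      exact Submodule.zero_mem _
  have stepB : (awaySub R M X (closure U ∩ Uᶜ)).relCls w (hw₂ _) = 0 := by
    haveI := ModuleCat.subsingleton_of_isZero
      ((ptDetermined_of_isCompact R M hn hK₂c).1 (i + 1) (by omega))
    exact Subsingleton.elim _ _
  obtain ⟨y, hy⟩ : ∃ y : (csingularChainComplex R M X).X (i + 2),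
      (csingularChainComplex R M X).d (i + 2) (i + 1) y - w ∈ awaySub R M X (closure U ∩ Uᶜ) (i + 1) :=
    (exists_d_prev_sub_mem_iff (ChainComplex.prev ℕ (i + 1)) w _).mp
      (((awaySub R M X (closure U ∩ Uᶜ)).relCls_eq_zero_iff w _).mp stepB)
  -- split `c = ∂y - w = c_U + c_V`
  have hc : (csingularChainComplex R M X).d (i + 2) (i + 1) y - w ∈ chainsIn R M X (U ∪ (closure U)ᶜ) (i + 1) :=
    chainsIn_mono R M hVU _ hy
  obtain ⟨cU, hcU, cV, hcV, hsum⟩ := Submodule.mem_sup.mp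
    (chainsIn_union_le_sup R M hUo isClosed_closure.isOpen_compl
      (Set.disjoint_compl_right_iff_subset.mpr hUK) (i + 1) hc)
  -- `∂w = -∂c`
  have hdd : (csingularChainComplex R M X).d (i + 1) i ((csingularChainComplex R M X).d (i + 2) (i + 1) y) = 0 := by
    rw [← ModuleCat.comp_apply, (csingularChainComplex R M X).d_comp_d]
    rfl
  have hdc' : (csingularChainComplex R M X).d (i + 1) i cU +
      (csingularChainComplex R M X).d (i + 1) i cV = -(csingularChainComplex R M X).d (i + 1) i w := by
    have h := congrArg (fun c => (csingularChainComplex R M X).d (i + 1) i c) hsum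
    simp only [map_add, map_sub, hdd, zero_sub] at h
    exact h
  have hdc : (csingularChainComplex R M X).d (i + 1) i w = -((csingularChainComplex R M X).d (i + 1) i cU +
      (csingularChainComplex R M X).d (i + 1) i cV) := by
    rw [hdc', neg_neg]
  -- `∂c_U + z ∈ C(U) ∩ C(V) = 0`
  have hkey : (csingularChainComplex R M X).d (i + 1) i cU + z = 0 := by
    have h1 : (csingularChainComplex R M X).d (i + 1) i cU + z ∈ chainsIn R M X U i :=
      Submodule.add_mem _ ((chainsInSub R M X U).d_mem hcU) hzU
    have h2 : (csingularChainComplex R M X).d (i + 1) i cU + z ∈ chainsIn R M X (closure U)ᶜ i := by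
      have e : (csingularChainComplex R M X).d (i + 1) i cU + z = -(((csingularChainComplex R M X).d (i + 1) i w - z) + (csingularChainComplex R M X).d (i + 1) i cV) := by
        rw [hdc]; abel
      rw [e]
      exact Submodule.neg_mem _ (Submodule.add_mem _ hv ((chainsInSub R M X (closure U)ᶜ).d_mem hcV))
    have h12 : (csingularChainComplex R M X).d (i + 1) i cU + z ∈ chainsIn R M X (U ∩ (closure U)ᶜ) i := by
      rw [chainsIn_inter]; exact ⟨h1, h2⟩
    rwa [(Set.disjoint_compl_right_iff_subset.mpr hUK).inter_eq, chainsIn_empty,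
      Submodule.mem_bot] at h12
  -- hence `z = ∂(-c_U)` is a boundary
  refine (homologyCls_eq_zero_iff z hz).mpr ((exists_d_prev_eq_iff (ChainComplex.prev ℕ i) z).mpr
    ⟨-cU, ?_⟩)
  rw [map_neg, neg_eq_iff_add_eq_zero.mpr hkey]

/-- **Dimension `0`**: a connected `0`-manifold is a point, hence compact; so the hypotheses
"connected, non-compact, modelled on `EuclideanSpace ℝ (Fin 0)`" are contradictory (each chart
source is an open singleton, so the topology is discrete). [folklore] -/
theorem not_noncompactSpace_of_chartedSpace_fin_zero [ChartedSpace (EuclideanSpace ℝ (Fin 0)) X]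
    [ConnectedSpace X] : ¬ NoncompactSpace X := by
  intro hX
  obtain ⟨x⟩ := (inferInstance : Nonempty X)
  have hsub : (chartAt (EuclideanSpace ℝ (Fin 0)) x).source ⊆ {x} := fun y hy => by
    have h : chartAt (EuclideanSpace ℝ (Fin 0)) x y = chartAt (EuclideanSpace ℝ (Fin 0)) x x :=
      (coords 0).injective (Subsingleton.elim _ _)
    exact (chartAt (EuclideanSpace ℝ (Fin 0)) x).injOn hy (mem_chart_source _ x) h
  have heq : (chartAt (EuclideanSpace ℝ (Fin 0)) x).source = {x} :=
    hsub.antisymm (Set.singleton_subset_iff.mpr (mem_chart_source _ x))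
  have hopen : IsOpen ({x} : Set X) := heq ▸ (chartAt (EuclideanSpace ℝ (Fin 0)) x).open_source
  have huniv : ({x} : Set X) = Set.univ := IsClopen.eq_univ ⟨isClosed_singleton, hopen⟩ ⟨x, rfl⟩
  exact hX.noncompact_univ (huniv ▸ isCompact_singleton)

/-- **Hatcher Prop. 3.29 in the concrete model, all coefficients and all dimensions `n`**: a
connected non-compact Hausdorff `n`-manifold `X : Type` has `Hᵢ(X; M) = 0` for `i ≥ n` (for `n = 0`
the hypotheses are contradictory). [cite: HatcherAT2002, Prop. 3.29] -/
theorem isZero_csingularHomology_of_noncompact [ConnectedSpace X] [NoncompactSpace X]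
    {i : ℕ} (hi : n ≤ i) : IsZero (csingularHomology R M X i) := by
  rcases Nat.eq_zero_or_pos n with hn | hn
  · subst hn
    exact absurd (inferInstance : NoncompactSpace X) (not_noncompactSpace_of_chartedSpace_fin_zero)
  · exact isZero_csingularHomology_of_noncompact_of_pos R M hn hi

/-- **Hatcher Prop. 3.29 for Mathlib's singular homology** (`Literature.AlgebraicTopology.SingularHomology.singularHomology`), via the
comparison isomorphism with the concrete model: a connected non-compact Hausdorff `n`-manifold
`X : Type` has `Hᵢ(X; M) = 0` for `i ≥ n`. [cite: HatcherAT2002, Prop. 3.29] -/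
theorem isZero_singularHomology_of_noncompact [ConnectedSpace X] [NoncompactSpace X]
    {i : ℕ} (hi : n ≤ i) : IsZero (singularHomology R M X i) :=
  (isZero_csingularHomology_of_noncompact R M hi).of_iso (csingularHomology.compIso R M X i).symm

end clocalHomology

/-- **Discharge of the named fact `isZero_singularHomology_of_noncompactSpace` for spaces
`X : Type`** (Hatcher 2002, Prop. 3.29): for every commutative ring `R`, every topological space
`X : Type` and every `n`, `isZero_singularHomology_of_noncompactSpace R X n` holds. (`X` is taken in
`Type` because the chart-by-chart transport of local homology is set up for spaces in one universe,
that of `ℝⁿ`; this is the generality consumed by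
`Literature.Topology.FourManifolds.compactSpace_of_homotopyEquiv_sphere_four_of_facts`.) [cite: HatcherAT2002, Prop. 3.29] -/
theorem isZero_singularHomology_of_noncompactSpace_holds (R : Type v) [CommRing R]
    (X : Type) [TopologicalSpace X] (n : ℕ) :
    isZero_singularHomology_of_noncompactSpace R X n := by
  intro _ _ _ _ i hi
  exact clocalHomology.isZero_singularHomology_of_noncompact R R hi

end Manifold

end Literature.AlgebraicTopology.SingularHomology

end
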